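import Mathlib.LinearAlgebra.CrossProduct
import Literature.Analysis.FluidPDE.MikadoShiftedPipes
import HarnessLib

/-!
# Pairwise disjoint Mikado pipes in `𝕋³` (Daneri–Székelyhidi 2017, proof of Lemma 2.3)

Sixth file of the Mikado tool-kit. Daneri–Székelyhidi, ARMA 224 (2017), Lemma 2.3 (= Lemma 5.1 of
Buckmaster–De Lellis–Székelyhidi–Vicol, CPAM 72 (2019)) build the Mikado flows
`W(R, ξ) = ∑_k Γ_k(R) ψ_k(ξ) k` from pipe profiles `ψ_k` around the `𝕋³`-periodic lines
`ℓ_{k,p_k} = {p_k + tk}` of the finitely many directions `k` of the geometric lemma, and observe: "since there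
are only a finite number of such lines, we may choose `p_k` and `r_k > 0` in such a way that
`supp ψ_i ∩ supp ψ_j = ∅` for all `i ≠ j`". This file PROVES that sentence for the fifteen directions
`k_x ∈ {e_i, e_i ± 2e_j}` of the tree's geometric lemma (`NashGeometric.dir`, `d = Fin 3`) with EXPLICIT data:

* `Mikado.exists_cert`: every integer vector `n ⊥ k_x` is an integer combination `n = A_x a` of the
  transverse forms of `Mikado.datum x`, with `|a|₁ ≤ |n|₁` (all `d`);
* `Mikado.shiftNum x ∈ ℤ³`, the shifts `p_x = shiftNum x / 7` (`Mikado.shiftVec`, `Mikado.shift = proj p_x`)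
  and the scale `Mikado.pipeConc = 60`; the arithmetic facts, checked by `decide`, that for `x ≠ x'` the
  common normal `n = k_x × k_{x'}` (Mathlib's `crossProduct`, notation `⨯₃`) has `|n|₁ ≤ 8` and
  `7 ∤ n ⬝ᵥ (shiftNum x - shiftNum x')`;
* `Mikado.tube_disjoint`: for `μ ≥ 60` the tubes of distinct directions, shifted by `p_x`, are pairwise
  disjoint (the phases `n·p_x + ∑a/2` differ by a non-zero multiple of `1/14` modulo `1`, while each tube
  has phase width `≤ 8/(4μ) < 1/28`), whence the pointwise identities `ψ_x ψ_{x'} = 0` and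
  `ψ_{x'} ∂ₗψ_x = 0` (`x ≠ x'`) for the shifted profiles `Mikado.psiS x μ (shift x)` used by the
  Mikado flows of `OnsagerBDSVPerturbationProofs` (BDSV Lemma 5.1).

Everything is proved; no named facts.

## Mathlib / tree search

Used from Mathlib: the cross product `crossProduct` on `Fin 3 → ℤ` (`Mathlib.LinearAlgebra.CrossProduct`,
scoped notation `⨯₃`, `dot_self_cross`, `dot_cross_self`, `cross_apply`), `dotProduct` (`⬝ᵥ`),
`Finset.sum_subtype`, `Int.one_le_abs`; `decide` evaluates `crossProduct`/`dotProduct` on the concrete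
integer vectors `NashGeometric.dir x`. From the tree: `NashGeometric.dir`/`Index`, `Mikado.datum`
(`axisDatum`, `pairDatum`, `pairA`), and `MikadoShiftedPipes` (`tubeOf_disjoint`, `tube`, `psiS`,
`mem_tube_of_psiS_ne_zero`, `mem_tube_of_partialDeriv_psiS_ne_zero`). Nothing on shifted/disjoint periodic
lines exists in Mathlib or the tree (`lean search "disjoint" "tube" "pipe"`).

## References

* S. Daneri, L. Székelyhidi Jr., ARMA 224 (2017) = arXiv:1603.09714, Lemma 2.3 (proof). [`DaneriSzekelyhidi2017`]
* T. Buckmaster, C. De Lellis, L. Székelyhidi Jr., V. Vicol, CPAM 72 (2019) = arXiv:1701.08678, Lemma 5.1.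
  [`BuckmasterEtAl2018`]
-/

noncomputable section

open Set Filter Topology Function MeasureTheory Metric Finset
open scoped ContDiff Matrix

namespace Literature.Analysis.FluidPDE

namespace Mikado

open FunctionSpaces FunctionSpaces.Torus NashGeometric Transverse

variable {d : Type*} [Fintype d] [DecidableEq d]

/-! ## Certificates: integer vectors orthogonal to `k_x` are integer combinations of the forms -/

section Cert

/-- Axis datum: every `n ∈ ℤ^d` with `n_i = 0` is `A a` with `a_{l'} = n_{l'}`, `|a|₁ ≤ |n|₁`. [folklore] -/
theorem exists_cert_axis (i : d) (n : d → ℤ) (hn : n i = 0) :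
    ∃ a : {l : d // l ≠ i} → ℤ, (∀ l, n l = ∑ l', (axisDatum i).A l l' * a l') ∧
      ∑ l', |a l'| ≤ ∑ l, |n l| := by
  refine ⟨fun l' => n l'.1, fun l => ?_, ?_⟩
  · show n l = ∑ l' : {l : d // l ≠ i}, (if l = l'.1 then (1 : ℤ) else 0) * n l'.1
    by_cases hl : l = i
    · subst hl
      rw [hn]
      symm
      exact Finset.sum_eq_zero fun l' _ => by simp [Ne.symm l'.2]
    · rw [Finset.sum_eq_single ⟨l, hl⟩]
      · simp
      · intro l' _ hl'
        have : l ≠ l'.1 := fun h => hl' (Subtype.ext h.symm)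
        simp [this]
      · simp
  · rw [← Finset.sum_subtype (Finset.univ.filter fun l => l ≠ i) (by simp) (fun l => |n l|)]
    exact Finset.sum_le_sum_of_subset_of_nonneg (Finset.filter_subset _ _) fun _ _ _ => abs_nonneg _

/-- Pair datum (`s = ∓1`): every `n ∈ ℤ^d` with `n_i = 2s n_j` (i.e. `n ⊥ e_i - 2s e_j`) is `A a` with
`a_i = s n_j`, `a_l = n_l` (`l ≠ i, j`), and `|a|₁ ≤ |n|₁`. [folklore] -/
theorem exists_cert_pair (i j : d) (hij : i ≠ j) (s : ℤ) (hs : s * s = 1) (n : d → ℤ)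
    (hn : n i = 2 * s * n j) :
    ∃ a : {l : d // l ≠ j} → ℤ, (∀ l, n l = ∑ l', pairA i j s l l' * a l') ∧ ∑ l', |a l'| ≤ ∑ l, |n l| := by
  set a' : d → ℤ := fun l => if l = i then s * n j else n l with ha'
  refine ⟨fun l' => a' l'.1, fun l => ?_, ?_⟩
  · by_cases hli : l = i
    · subst hli
      rw [Finset.sum_eq_single ⟨l, hij⟩]
      · simp [pairA, ha', hn]; ring
      · intro l' _ hl'
        have h1 : l'.1 ≠ l := fun h => hl' (Subtype.ext h)
        simp [pairA, h1, Ne.symm h1]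
      · simp
    · by_cases hlj : l = j
      · subst hlj
        rw [Finset.sum_eq_single ⟨i, hij⟩]
        · simp only [pairA, if_true, hli, if_false, ha']
          rw [← mul_assoc, hs, one_mul]
        · intro l' _ hl'
          have h1 : l'.1 ≠ i := fun h => hl' (Subtype.ext h)
          have h2 : l ≠ l'.1 := fun h => l'.2 h.symm
          simp [pairA, h1, h2]
        · simp
      · rw [Finset.sum_eq_single ⟨l, hlj⟩]
        · simp [pairA, hli, ha']
        · intro l' _ hl'
          have h2 : l ≠ l'.1 := fun h => hl' (Subtype.ext h.symm)
          by_cases h1 : l'.1 = i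
          · simp [pairA, h1, hli, hlj]
          · simp [pairA, h1, h2]
        · simp
  · have hle : ∀ l, |a' l| ≤ |n l| := by
      intro l
      by_cases hl : l = i
      · subst hl
        simp only [ha', if_true, hn]
        have : |s| = 1 := by
          rcases Int.eq_one_or_neg_one_of_mul_eq_one hs with h | h <;> simp [h]
        calc |s * n j| = |n j| := by rw [abs_mul, this, one_mul]
          _ ≤ 2 * |n j| := by linarith [abs_nonneg (n j)]
          _ = |2 * s * n j| := by rw [abs_mul, abs_mul, this, abs_two, mul_one]
      · simp [ha', hl]
    calc ∑ l' : {l : d // l ≠ j}, |a' l'.1| = ∑ l ∈ Finset.univ.filter (fun l => l ≠ j), |a' l| :=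
          (Finset.sum_subtype (Finset.univ.filter fun l => l ≠ j) (by simp) (fun l => |a' l|)).symm
      _ ≤ ∑ l, |a' l| :=
          Finset.sum_le_sum_of_subset_of_nonneg (Finset.filter_subset _ _) fun _ _ _ => abs_nonneg _
      _ ≤ ∑ l, |n l| := Finset.sum_le_sum fun l _ => hle l

/-- **Certificates for the directions of the geometric lemma**: every integer vector `n` orthogonal to
`k_x` is an integer combination `n = A_x a` of the transverse forms of `datum x`, with `|a|₁ ≤ |n|₁`
(so the characters `χ_n` are constant on the pipes of direction `k_x`). [folklore] -/
theorem exists_cert (x : Index d) (n : d → ℤ) (hn : ∑ l, n l * dir x l = 0) :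
    ∃ a : Slot x → ℤ, (∀ l, n l = ∑ l', (datum x).A l l' * a l') ∧ ∑ l', |a l'| ≤ ∑ l, |n l| := by
  rcases x with i | ⟨⟨i, j⟩, hij⟩ | ⟨⟨i, j⟩, hij⟩
  · have hni : n i = 0 := by
      simpa [dir, Pi.single_apply] using hn
    exact exists_cert_axis i n hni
  · dsimp only at hij
    have h : n i + n j * 2 = 0 := by
      have hj : j ≠ i := fun h => hij h.symm
      simpa [dir, Pi.single_apply, mul_add, Finset.sum_add_distrib, Finset.mul_sum, hj] using hn
    exact exists_cert_pair i j hij (-1) (by norm_num) n (by linarith)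
  · dsimp only at hij
    have h : n i - n j * 2 = 0 := by
      have hj : j ≠ i := fun h => hij h.symm
      simpa [dir, Pi.single_apply, mul_sub, Finset.sum_sub_distrib, Finset.mul_sum, hj] using hn
    exact exists_cert_pair i j hij 1 (by norm_num) n (by linarith)

end Cert

/-! ## Dimension three: explicit shifts and pairwise disjoint tubes -/

section Three

/-- **The shift numerators** `P_x ∈ {0, …, 6}³` of the fifteen directions (`p_x = P_x / 7`): for the axes
`e₀, e₁, e₂`: `(0,0,0), (0,0,1), (1,1,0)`; for `e_i + 2e_j`, `(i,j) = (0,1), (0,2), (1,0), (1,2), (2,0), (2,1)`: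
`(0,0,2), (0,3,0), (0,0,3), (2,0,2), (0,2,0), (3,1,0)`; for `e_i - 2e_j`, same order:
`(0,0,5), (1,4,0), (0,1,4), (4,0,1), (1,5,0), (5,0,2)` (found by a finite search; any table passing
`shiftNum_check` serves). [folklore] -/
def shiftNum : Index (Fin 3) → Fin 3 → ℤ :=
  Sum.elim (fun i => (![![0, 0, 0], ![0, 0, 1], ![1, 1, 0]] : Fin 3 → Fin 3 → ℤ) i)
    (Sum.elim
      (fun p => (![![![0, 0, 0], ![0, 0, 2], ![0, 3, 0]],
                  ![![0, 0, 3], ![0, 0, 0], ![2, 0, 2]],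
                  ![![0, 2, 0], ![3, 1, 0], ![0, 0, 0]]] : Fin 3 → Fin 3 → Fin 3 → ℤ) p.1.1 p.1.2)
      (fun p => (![![![0, 0, 0], ![0, 0, 5], ![1, 4, 0]],
                  ![![0, 1, 4], ![0, 0, 0], ![4, 0, 1]],
                  ![![1, 5, 0], ![5, 0, 2], ![0, 0, 0]]] : Fin 3 → Fin 3 → Fin 3 → ℤ) p.1.1 p.1.2))

/-- The shifts `p_x = P_x / 7 ∈ ℝ³`. [folklore] -/
def shiftVec (x : Index (Fin 3)) : EuclideanSpace ℝ (Fin 3) :=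
  WithLp.toLp 2 fun l => (shiftNum x l : ℝ) / 7

/-- The shifts on the torus, `proj p_x ∈ 𝕋³`. [folklore] -/
def shift (x : Index (Fin 3)) : UnitAddTorus (Fin 3) := proj (shiftVec x)

/-- The concentration scale `μ₀ = 60` of the pipes (any `μ > 56 = 7 · 8` serves). [folklore] -/
def pipeConc : ℝ := 60

/-- `1 ≤ μ₀`. [folklore] -/
theorem one_le_pipeConc : (1 : ℝ) ≤ pipeConc := by norm_num [pipeConc]

/-- **The arithmetic separation check**: for `x ≠ x'`, `7 ∤ (k_x × k_{x'}) ⬝ᵥ (P_x - P_{x'})`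
(a finite computation, `decide`; in particular no two directions are parallel). [folklore] -/
theorem shiftNum_check : ∀ x x' : Index (Fin 3), x ≠ x' →
    ¬ ((7 : ℤ) ∣ (dir x ⨯₃ dir x') ⬝ᵥ (shiftNum x - shiftNum x')) := by
  decide

/-- `|k_x × k_{x'}|₁ ≤ 8` for all pairs of directions (`decide`). [folklore] -/
theorem cross_dir_bound : ∀ x x' : Index (Fin 3), ∑ l, |(dir x ⨯₃ dir x') l| ≤ 8 := by
  decide

/-- **Pairwise disjoint pipes** (DaSz17, proof of Lemma 2.3: "we may choose `p_k` and `r_k > 0` in such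
a way that `supp ψ_i ∩ supp ψ_j = ∅`"): for `μ ≥ 60` and `x ≠ x'` the tubes of directions `k_x`, `k_{x'}`
shifted by `p_x`, `p_{x'}` are disjoint. Proof: with the common normal `n = k_x ⨯₃ k_{x'}` and the
certificates `n = A_x a = A_{x'} a'`, the phases of the two tubes along `χ_n` differ by
`n·(P_x - P_{x'})/7 + (∑a - ∑a')/2 ∉ ℤ + (-1/14, 1/14)` while their widths add up to `≤ 16/(4μ) < 1/14`.
[cite: DaneriSzekelyhidi2017, Lemma 2.3 (proof)] -/
theorem tube_disjoint {x x' : Index (Fin 3)} (hxx' : x ≠ x') {μ : ℝ} (hμ : pipeConc ≤ μ)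
    {y : UnitAddTorus (Fin 3)} (hy : y ∈ tube x μ (shift x)) (hy' : y ∈ tube x' μ (shift x')) : False := by
  set n : Fin 3 → ℤ := dir x ⨯₃ dir x' with hn
  have hnx : ∑ l, n l * dir x l = 0 := by
    have h := dot_self_cross (dir x) (dir x')
    rwa [dotProduct_comm] at h
  have hnx' : ∑ l, n l * dir x' l = 0 := by
    have h := dot_cross_self (dir x) (dir x')
    rwa [dotProduct_comm] at h
  obtain ⟨a, hna, ha⟩ := exists_cert x n hnx
  obtain ⟨a', hna', ha'⟩ := exists_cert x' n hnx'
  have hμ0 : (60 : ℝ) ≤ μ := hμ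
  set N : ℤ := n ⬝ᵥ (shiftNum x - shiftNum x') with hN
  have hN7 : ¬ (7 : ℤ) ∣ N := shiftNum_check x x' hxx'
  have hn8 : (∑ l, |n l|) ≤ 8 := cross_dir_bound x x'
  have hb : (∑ l', |(a l' : ℝ)|) ≤ 8 := by
    have h : ((∑ l', |a l'| : ℤ) : ℝ) ≤ 8 := by exact_mod_cast ha.trans hn8
    push_cast at h
    exact h
  have hb' : (∑ l', |(a' l' : ℝ)|) ≤ 8 := by
    have h : ((∑ l', |a' l'| : ℤ) : ℝ) ≤ 8 := by exact_mod_cast ha'.trans hn8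
    push_cast at h
    exact h
  refine tubeOf_disjoint (datum x) (datum x') hna hna' (shiftVec x) (shiftVec x') (μ := μ) (δ := 1 / 14)
    ?_ ?_ hy hy'
  · intro k
    have hq : (∑ l, (n l : ℝ) * (shiftVec x l - shiftVec x' l)) = (N : ℝ) / 7 := by
      rw [hN, dotProduct]
      push_cast
      rw [Finset.sum_div]
      refine Finset.sum_congr rfl fun l _ => ?_
      simp only [shiftVec, PiLp.toLp_apply, Pi.sub_apply]
      push_cast
      ring
    have hcast : ((∑ l', (a l' : ℝ)) - ∑ l', (a' l' : ℝ)) = (((∑ l', a l') - ∑ l', a' l' : ℤ) : ℝ) := by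
      push_cast
      rfl
    rw [hq, hcast]
    set D : ℤ := (∑ l', a l') - ∑ l', a' l' with hD
    have hne : (2 * N + 7 * D - 14 * k : ℤ) ≠ 0 := by
      intro h0
      apply hN7
      omega
    have h1 : (1 : ℝ) ≤ |((2 * N + 7 * D - 14 * k : ℤ) : ℝ)| := by
      exact_mod_cast Int.one_le_abs hne
    have heq : (N : ℝ) / 7 + (D : ℝ) / 2 - (k : ℝ) = ((2 * N + 7 * D - 14 * k : ℤ) : ℝ) / 14 := by
      push_cast
      ring
    rw [heq, abs_div, abs_of_pos (by norm_num : (0 : ℝ) < 14)]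
    linarith
  · rw [div_lt_iff₀ (by linarith)]
    linarith

/-- **Disjoint supports**: `ψ_x(y - p_x) ψ_{x'}(y - p_{x'}) = 0` for `x ≠ x'` (`μ ≥ 60`).
[cite: DaneriSzekelyhidi2017, Lemma 2.3 (proof)] -/
theorem psiS_mul_psiS_eq_zero {x x' : Index (Fin 3)} (hxx' : x ≠ x') {μ : ℝ} (hμ : pipeConc ≤ μ)
    (y : UnitAddTorus (Fin 3)) : psiS x μ (shift x) y * psiS x' μ (shift x') y = 0 := by
  by_contra h
  have h1 : psiS x μ (shift x) y ≠ 0 := fun h' => h (by rw [h', zero_mul])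
  have h2 : psiS x' μ (shift x') y ≠ 0 := fun h' => h (by rw [h', mul_zero])
  have hμ1 : (1 : ℝ) ≤ μ := one_le_pipeConc.trans hμ
  exact tube_disjoint hxx' hμ (mem_tube_of_psiS_ne_zero hμ1 h1) (mem_tube_of_psiS_ne_zero hμ1 h2)

/-- **Straight pipes do not interact**: `ψ_{x'}(y - p_{x'}) ∂ₗψ_x(y - p_x) = 0` for `x ≠ x'` (`μ ≥ 60`).
[cite: DaneriSzekelyhidi2017, Lemma 2.3 (proof)] -/
theorem psiS_mul_partialDeriv_psiS_eq_zero {x x' : Index (Fin 3)} (hxx' : x ≠ x') {μ : ℝ}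
    (hμ : pipeConc ≤ μ) (l : Fin 3) (y : UnitAddTorus (Fin 3)) :
    psiS x' μ (shift x') y * partialDeriv l (psiS x μ (shift x)) y = 0 := by
  by_contra h
  have h1 : psiS x' μ (shift x') y ≠ 0 := fun h' => h (by rw [h', zero_mul])
  have h2 : partialDeriv l (psiS x μ (shift x)) y ≠ 0 := fun h' => h (by rw [h', mul_zero])
  have hμ1 : (1 : ℝ) ≤ μ := one_le_pipeConc.trans hμ
  exact tube_disjoint hxx' hμ (mem_tube_of_partialDeriv_psiS_ne_zero hμ1 l h2)
    (mem_tube_of_psiS_ne_zero hμ1 h1)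

end Three

end Mikado

end Literature.Analysis.FluidPDE
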